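import Summits.HodgeConjecture.HodgeConjecture.Cruxes.BlochSeedDiscOne.IntegralityGap

/-!
line stmt-HodgeConjecture-18881 Cruxes/BlochSeedDiscOne/Lines/birth.lean 814a6a70c14e831a stub_rung_pad4_seedAt

# HeightTower — the brief's «tower-height induction h → h+1» typed AND PROVED in the model of record
(plan-lens-HodgeAV-strengthen g9, lens «strengthen»; STRENGTHEN-MEMO-13 / S⁺-ledger v1.13 rows #89–#93)

STATUS: evidence + typed files, not rungs. Letters ≠ sheaves. Nothing here is proved toward HC / HC_CM / HC_AV / №4 / 26512 /
18881 / H2: every theorem below is about the finite letter model `DepthBoundA4.Design` (the widened (A4) road of colour-1 ∕ gs-eng-2),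
and NONE of them proves `Nonex 14 199 8`, `DepthBound 14 199 8 3`, `stub_depthBound_three`, or any single floor `FloorFree h 199 8`
with `h ≥ 6`. What is kernel-checked is the EQUIVALENCE that turns the conjecture of record into a tower of nine floor statements.

WHAT IS PROVED (sorry-free; no axiom / instance / native_decide; imports `IntegralityGap` only):
* §1–§4 The UNIT SHIFT `(a; x, y) ↦ (a + t; x, y)` of every letter of every cell (= `⊗ O(t·h)` on each factor) preserves copies,
  rank, supports, (A4) liveness (`AmpleAbove` only sees differences), co-levels, `μ = T(eeee)` and the vanishing half (A1).1, and
  moves the alphabet height `h ↦ h + t` (`onAlphabet_shift`; a down-shift needs `a + t ≥ 0` on the support). The single-factor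
  class tensor expands as `1, e, ē ↦` themselves, `h ↦ h + t·1`, `pt ↦ pt + 2t·h + t²·1` (`T_shiftAtD_of_ne/_h/_pt`).
* §5 (A1).2 («e-free words of equal degree agree») is preserved by the FULL four-factor shift (`eAgree_shiftD`, hence `a1_shiftD`;
  one factor alone does not preserve it). The proof is a finite LETTER CALCULUS of the kind the brief asks for: pair agreement
  `PairAgree f g` (α) follows from (A1).2, (β) survives the shift of a third factor, (γ) survives the shift of the pair itself —
  nine binomial identities `Hf = Ff ∘ deg`, closed by `ring` — and (δ) pair agreement on the six pairs returns (A1).2 through the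
  balancing normal form `nf = bal 2 3 ∘ bal 1 3 ∘ bal 1 2 ∘ bal 0 3 ∘ bal 0 2 ∘ bal 0 1`, whose degree vector depends on the total
  degree only (`phase1–3`, `omega`).
* §6 THE TOWER. `FloorFree h B r` := no valid design at height `h` uses a floor letter `a = 0` (⟺ `DepthBound h B r (h − 1)`,
  `floorFree_iff_depthBound`). One storey: `Nonex (h+1) B r ↔ Nonex h B r ∧ FloorFree (h+1) B r` (`nonex_succ_iff`: a floor-free
  design shifts down, any design shifts up); n storeys: `nonex_add_iff`. Ring certificates ARE low-height non-existence:
  `RingsEmpty h B r c ↔ Nonex c B r` for `c ≤ h` (`ringsEmpty_iff_nonex`); a depth bound frees the floors above it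
  (`floorFree_of_depthBound`); NONEX is inherited downwards (`nonex_of_nonex_up`).
* §7 THE INSTANCE. With gs-eng-2's `RingFiveEmpty.ringsEmpty_14_199_8_5 : RingsEmpty 14 199 8 5` (= `Nonex 5 199 8`,
  `nonex_five_of_rings`) as a hypothesis: `Nonex 14 199 8 ↔ ∀ h ∈ [6, 14], FloorFree h 199 8` (`nonex_14_iff_floors`). So the
  conjecture of record (`Nonex 14 199 8` ⟺ `DepthBound 14 199 8 5`, `LegAIsNonex.depthBound_five_iff_nonex`) IS nine deepest-ring
  exclusions, one per storey `h = 6, …, 14`, and the inductive step `h → h + 1` of the brief's tower is exactly `FloorFree (h+1)`.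

WHAT THE TOWER DOES NOT DO (honest reading). The step is not a letter calculus that closes by itself: each `FloorFree h 199 8` is a
genuine statement. Strengthen-g9's exact LP census (STRENGTHEN-MEMO-13; hub-local engines, exact rational arithmetic, files and sha256
there) finds RATIONAL (A1)(A4) pseudo-designs with `μ ≠ 0`, copies `≤ 199`, rank `≥ 8` and a floor letter at every height
`h ∈ {8, …, 14}` (after the down-shift: cone designs `C644-B199` [h = 8], `C545-B199` [h = 9]; g8's `D455-B199` [10], `P356-734` [11],
`P266-644` [12], `P167-545` [13], `P077-*` [14]); so seven of the nine floors are INTEGRALITY statements — no LP dual ∕ Farkas ∕ ring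
certificate proves them — and only the storeys `h = 6, 7` are LP-open (their widest-base cones are exactly infeasible; the full
ring-6/7 LPs are gs-eng-2's programme; ring 5 itself holds at the knife-edge LP value 199.079). The duality `ι_h` of the brief has no
analogue on the one-directional (A4) road (P below N); we record that instead of forcing it. The other inductive S⁺ of the brief,
«≤ k distinct tops» (`IntegralityGap.KTops`), is rationally false already at k = 2 (g8, MEMO-12 F6) and is not revisited here.

Model: `DepthBoundA4.lean` v1.8 (Letter, Cell, Design, Sym, Word, cellCoef, T, μ, A1, A4, OnAlphabet, DepthBound, RingsEmpty),
`IntegralityGap.lean` (Nonex). Words by director-hodge only.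
-/

set_option linter.dupNamespace false
set_option autoImplicit false

namespace Summit.HodgeConjecture.HodgeConjecture.Cruxes.BlochSeedDiscOne.HeightTower

open Summit.HodgeConjecture.HodgeConjecture.Cruxes.BlochSeedDiscOne.DepthBoundA4
open Summit.HodgeConjecture.HodgeConjecture.Cruxes.BlochSeedDiscOne.IntegralityGap
/-! ## §0 Weighted sums (verbatim the bookkeeping of `TwoAdicMuLaw` §3, re-declared so that this file imports `IntegralityGap` only) -/

/-- `Σ m·u(c)` over a list of (cell, multiplicity) entries. -/
def wsum (L : List (Cell × ℕ)) (u : Cell → GaussianInt) : GaussianInt :=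
  (L.map fun cm => (cm.2 : GaussianInt) * u cm.1).sum

theorem wsum_add (L : List (Cell × ℕ)) (u v : Cell → GaussianInt) :
    wsum L (fun c => u c + v c) = wsum L u + wsum L v := by
  induction L with
  | nil => simp [wsum]
  | cons a t ih =>
    simp only [wsum, List.map_cons, List.sum_cons] at ih ⊢
    rw [ih]; ring

theorem wsum_smul (L : List (Cell × ℕ)) (r : GaussianInt) (u : Cell → GaussianInt) :
    wsum L (fun c => r * u c) = r * wsum L u := by
  induction L with
  | nil => simp [wsum]
  | cons a t ih =>
    simp only [wsum, List.map_cons, List.sum_cons] at ih ⊢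
    rw [ih]; ring

/-- `T` as a linear functional of the cell-coefficient function. -/
def Tf (D : Design) (u : Cell → GaussianInt) : GaussianInt := wsum D.N u - wsum D.P u

theorem T_eq_Tf (D : Design) (w : Word) : D.T w = Tf D (fun c => cellCoef c w) := rfl

theorem Tf_add (D : Design) (u v : Cell → GaussianInt) : Tf D (fun c => u c + v c) = Tf D u + Tf D v := by
  unfold Tf; rw [wsum_add, wsum_add]; ring

theorem Tf_smul (D : Design) (r : GaussianInt) (u : Cell → GaussianInt) : Tf D (fun c => r * u c) = r * Tf D u := by
  unfold Tf; rw [wsum_smul, wsum_smul]; ring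

theorem Tf_congr (D : Design) {u v : Cell → GaussianInt} (h : ∀ c, u c = v c) : Tf D u = Tf D v := by
  have : u = v := funext h
  rw [this]

/-! ## §1 The shift `a ↦ a + t` of a letter (= tensoring the line bundle by `O(t·h)` on that factor) -/

/-- Shift the `h`-coefficient: `(a; x, y) ↦ (a + t; x, y)`. -/
def shiftL (t : ℤ) (ℓ : Letter) : Letter := ⟨ℓ.a + t, ℓ.x, ℓ.y⟩

@[simp] theorem shiftL_a (t : ℤ) (ℓ : Letter) : (shiftL t ℓ).a = ℓ.a + t := rfl
@[simp] theorem shiftL_x (t : ℤ) (ℓ : Letter) : (shiftL t ℓ).x = ℓ.x := rfl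
@[simp] theorem shiftL_y (t : ℤ) (ℓ : Letter) : (shiftL t ℓ).y = ℓ.y := rfl
@[simp] theorem shiftL_beta (t : ℤ) (ℓ : Letter) : (shiftL t ℓ).beta = ℓ.beta := rfl
@[simp] theorem shiftL_colevel (t : ℤ) (ℓ : Letter) : (shiftL t ℓ).colevel = ℓ.colevel := rfl
@[simp] theorem shiftL_bnorm (t : ℤ) (ℓ : Letter) : (shiftL t ℓ).bnorm = ℓ.bnorm := rfl

theorem shiftL_height (t : ℤ) (ℓ : Letter) : (shiftL t ℓ).height = ℓ.height + t := by
  simp only [Letter.height, shiftL_a, shiftL_x, shiftL_y]; ring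

theorem shiftL_selfInt (t : ℤ) (ℓ : Letter) : (shiftL t ℓ).selfInt = ℓ.selfInt + 2 * t * ℓ.a + t ^ 2 := by
  simp only [Letter.selfInt, shiftL_a, shiftL_bnorm]; ring

theorem shiftL_shiftL (s t : ℤ) (ℓ : Letter) : shiftL s (shiftL t ℓ) = shiftL (t + s) ℓ := by
  cases ℓ; simp only [shiftL, Letter.mk.injEq, and_true]; ring

theorem shiftL_zero (ℓ : Letter) : shiftL 0 ℓ = ℓ := by
  cases ℓ; simp [shiftL]

/-- `AmpleAbove` only sees differences: it is shift-invariant. -/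
theorem ampleAbove_shiftL (t : ℤ) (ℓ ℓ' : Letter) : AmpleAbove (shiftL t ℓ) (shiftL t ℓ') ↔ AmpleAbove ℓ ℓ' := by
  simp only [AmpleAbove, shiftL_a, shiftL_x, shiftL_y, add_lt_add_iff_right, add_sub_add_right_eq_sub]

/-- Shift the letter on factor `k` only. -/
def shiftAt (k : Fin 4) (t : ℤ) (c : Cell) : Cell := Function.update c k (shiftL t (c k))

@[simp] theorem shiftAt_self (k : Fin 4) (t : ℤ) (c : Cell) : shiftAt k t c k = shiftL t (c k) := by
  simp [shiftAt]

theorem shiftAt_of_ne {k g : Fin 4} (h : g ≠ k) (t : ℤ) (c : Cell) : shiftAt k t c g = c g := by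
  simp [shiftAt, Function.update_of_ne h]

theorem shiftAt_comm (j k : Fin 4) (s t : ℤ) (c : Cell) : shiftAt j s (shiftAt k t c) = shiftAt k t (shiftAt j s c) := by
  by_cases hjk : j = k
  · subst hjk
    funext g
    by_cases hg : g = j
    · subst hg; simp [shiftL_shiftL, add_comm]
    · simp [shiftAt_of_ne hg]
  · funext g
    by_cases hgj : g = j
    · subst hgj; simp [shiftAt_of_ne hjk]
    · by_cases hgk : g = k
      · subst hgk; simp [shiftAt_of_ne hgj]
      · simp [shiftAt_of_ne hgj, shiftAt_of_ne hgk]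

/-- Shift every factor. -/
def shiftCell (t : ℤ) (c : Cell) : Cell := fun g => shiftL t (c g)

theorem shiftCell_eq (t : ℤ) (c : Cell) :
    shiftCell t c = shiftAt 0 t (shiftAt 1 t (shiftAt 2 t (shiftAt 3 t c))) := by
  have h01 : (0 : Fin 4) ≠ 1 := by decide
  have h02 : (0 : Fin 4) ≠ 2 := by decide
  have h03 : (0 : Fin 4) ≠ 3 := by decide
  have h12 : (1 : Fin 4) ≠ 2 := by decide
  have h13 : (1 : Fin 4) ≠ 3 := by decide
  have h23 : (2 : Fin 4) ≠ 3 := by decide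
  funext g
  fin_cases g
  · simp [shiftCell, shiftAt_of_ne h01, shiftAt_of_ne h02, shiftAt_of_ne h03]
  · simp [shiftCell, shiftAt_of_ne h01.symm, shiftAt_of_ne h12, shiftAt_of_ne h13]
  · simp [shiftCell, shiftAt_of_ne h02.symm, shiftAt_of_ne h12.symm, shiftAt_of_ne h23]
  · simp [shiftCell, shiftAt_of_ne h03.symm, shiftAt_of_ne h13.symm, shiftAt_of_ne h23.symm]

theorem live_shiftCell (t : ℤ) (x y : Cell) : Live (shiftCell t x) (shiftCell t y) ↔ Live x y := by
  simp only [Live, shiftCell, ampleAbove_shiftL]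

/-! ## §2 Shifted designs: supports, copies, rank, alphabet, liveness -/

/-- Apply a cell map to both lists of a design (multiplicities unchanged). -/
def mapD (φ : Cell → Cell) (D : Design) : Design :=
  ⟨D.N.map fun cm => (φ cm.1, cm.2), D.P.map fun cm => (φ cm.1, cm.2)⟩

theorem map_snd_mapD (φ : Cell → Cell) (L : List (Cell × ℕ)) :
    (L.map fun cm => (φ cm.1, cm.2)).map Prod.snd = L.map Prod.snd := by
  simp [List.map_map, Function.comp_def]

theorem supp_mapD (φ : Cell → Cell) (L : List (Cell × ℕ)) :
    ((L.map fun cm => (φ cm.1, cm.2)).filter fun cm => 0 < cm.2).map Prod.fst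
      = ((L.filter fun cm => 0 < cm.2).map Prod.fst).map φ := by
  induction L with
  | nil => simp
  | cons a l ih =>
    by_cases ha : 0 < a.2
    · simp [ha, ih]
    · simp [ha, ih]

theorem suppN_mapD (φ : Cell → Cell) (D : Design) : (mapD φ D).suppN = D.suppN.map φ := supp_mapD φ D.N
theorem suppP_mapD (φ : Cell → Cell) (D : Design) : (mapD φ D).suppP = D.suppP.map φ := supp_mapD φ D.P

@[simp] theorem copies_mapD (φ : Cell → Cell) (D : Design) : (mapD φ D).copies = D.copies := by
  simp only [Design.copies, mapD, map_snd_mapD]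

@[simp] theorem rank_mapD (φ : Cell → Cell) (D : Design) : (mapD φ D).rank = D.rank := by
  simp only [Design.rank, mapD, map_snd_mapD]

theorem wsum_mapD (φ : Cell → Cell) (L : List (Cell × ℕ)) (u : Cell → GaussianInt) :
    wsum (L.map fun cm => (φ cm.1, cm.2)) u = wsum L (fun c => u (φ c)) := by
  simp [wsum, List.map_map, Function.comp_def]

theorem T_mapD (φ : Cell → Cell) (D : Design) (w : Word) :
    (mapD φ D).T w = Tf D (fun c => cellCoef (φ c) w) := by
  rw [T_eq_Tf]; simp only [Tf, mapD, wsum_mapD]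

/-- The design shifted on factor `k`. -/
def shiftAtD (k : Fin 4) (t : ℤ) (D : Design) : Design := mapD (shiftAt k t) D

/-- The design shifted on every factor. -/
def shiftD (t : ℤ) (D : Design) : Design := mapD (shiftCell t) D

theorem mapD_mapD (φ ψ : Cell → Cell) (D : Design) : mapD φ (mapD ψ D) = mapD (fun c => φ (ψ c)) D := by
  simp [mapD, List.map_map, Function.comp_def]

theorem shiftD_eq_shiftAtD (t : ℤ) (D : Design) :
    shiftD t D = shiftAtD 0 t (shiftAtD 1 t (shiftAtD 2 t (shiftAtD 3 t D))) := by
  simp only [shiftD, shiftAtD, mapD_mapD, ← shiftCell_eq]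

theorem shiftAtD_comm (j k : Fin 4) (s t : ℤ) (D : Design) :
    shiftAtD j s (shiftAtD k t D) = shiftAtD k t (shiftAtD j s D) := by
  simp only [shiftAtD, mapD_mapD, shiftAt_comm j k s t]

@[simp] theorem copies_shift (D : Design) (t : ℤ) : (shiftD t D).copies = D.copies := copies_mapD _ D
@[simp] theorem rank_shift (D : Design) (t : ℤ) : (shiftD t D).rank = D.rank := rank_mapD _ D

theorem suppN_shift (D : Design) (t : ℤ) : (shiftD t D).suppN = D.suppN.map (shiftCell t) := suppN_mapD _ D
theorem suppP_shift (D : Design) (t : ℤ) : (shiftD t D).suppP = D.suppP.map (shiftCell t) := suppP_mapD _ D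

theorem a4_shift (D : Design) (t : ℤ) (h4 : D.A4) : (shiftD t D).A4 := by
  obtain ⟨hP, hN⟩ := h4
  refine ⟨?_, ?_⟩
  · intro x hx
    rw [suppP_shift, List.mem_map] at hx
    obtain ⟨x₀, hx₀, rfl⟩ := hx
    obtain ⟨y₀, hy₀, hl⟩ := hP x₀ hx₀
    exact ⟨shiftCell t y₀, by rw [suppN_shift]; exact List.mem_map.mpr ⟨y₀, hy₀, rfl⟩, (live_shiftCell t x₀ y₀).mpr hl⟩
  · intro y hy
    rw [suppN_shift, List.mem_map] at hy
    obtain ⟨y₀, hy₀, rfl⟩ := hy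
    obtain ⟨x₀, hx₀, hl⟩ := hN y₀ hy₀
    exact ⟨shiftCell t x₀, by rw [suppP_shift]; exact List.mem_map.mpr ⟨x₀, hx₀, rfl⟩, (live_shiftCell t x₀ y₀).mpr hl⟩

/-- Alphabet transport: a height-`h` design all of whose letters have `a + t ≥ 0` shifts to a height-`h + t` design. -/
theorem onAlphabet_shift (D : Design) (h t : ℤ) (hA : D.OnAlphabet h)
    (ha : ∀ c ∈ D.suppN ++ D.suppP, ∀ f : Fin 4, 0 ≤ (c f).a + t) : (shiftD t D).OnAlphabet (h + t) := by
  intro c hc f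
  have hc' : c ∈ (D.suppN ++ D.suppP).map (shiftCell t) := by
    rw [List.map_append, ← suppN_shift, ← suppP_shift]; exact hc
  obtain ⟨c₀, hc₀, rfl⟩ := List.mem_map.mp hc'
  refine ⟨?_, ?_⟩
  · rw [shiftCell, shiftL_height, (hA c₀ hc₀ f).1]
  · simpa [shiftCell] using ha c₀ hc₀ f

/-- Up-shifts (`t ≥ 0`) need no hypothesis on the letters. -/
theorem onAlphabet_shift_up (D : Design) (h t : ℤ) (ht : 0 ≤ t) (hA : D.OnAlphabet h) : (shiftD t D).OnAlphabet (h + t) :=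
  onAlphabet_shift D h t hA fun c hc f => add_nonneg (hA c hc f).2 ht

/-- Co-levels are shift-invariant. -/
theorem colevel_shift (D : Design) (t : ℤ) (c₀ : ℤ) (hc : ∀ c ∈ D.suppN ++ D.suppP, ∀ f : Fin 4, (c f).colevel ≤ c₀) :
    ∀ c ∈ (shiftD t D).suppN ++ (shiftD t D).suppP, ∀ f : Fin 4, (c f).colevel ≤ c₀ := by
  intro c hc' f
  have hc'' : c ∈ (D.suppN ++ D.suppP).map (shiftCell t) := by
    rw [List.map_append, ← suppN_shift, ← suppP_shift]; exact hc'
  obtain ⟨c₁, hc₁, rfl⟩ := List.mem_map.mp hc''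
  simpa [shiftCell] using hc c₁ hc₁ f


/-! ## §3 One factor at a time: the class tensor of a single-factor shift

`coef s (a + t; β)` in terms of `coef · (a; β)`: `1, e, ē` unchanged, `h ↦ h + t·1`, `pt ↦ pt + 2t·h + t²·1`
(`ch(L ⊗ O(t h)) = ch(L)·(1 + t h + t² pt)` on a factor with `h² = 2 pt`). -/

/-- the product of the coefficients on the factors other than `k`. -/
def restCoef (k : Fin 4) (c : Cell) (w : Word) : GaussianInt :=
  ∏ f ∈ (Finset.univ : Finset (Fin 4)).erase k, (w f).coef (c f)

theorem cellCoef_split (k : Fin 4) (c : Cell) (w : Word) : cellCoef c w = (w k).coef (c k) * restCoef k c w := by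
  unfold cellCoef restCoef
  exact (Finset.mul_prod_erase Finset.univ (fun f => (w f).coef (c f)) (Finset.mem_univ k)).symm

theorem cellCoef_shiftAt_split (k : Fin 4) (t : ℤ) (c : Cell) (w : Word) :
    cellCoef (shiftAt k t c) w = (w k).coef (shiftL t (c k)) * restCoef k c w := by
  unfold cellCoef restCoef
  rw [← Finset.mul_prod_erase Finset.univ (fun f => (w f).coef (shiftAt k t c f)) (Finset.mem_univ k), shiftAt_self]
  congr 1
  refine Finset.prod_congr rfl fun f hf => ?_
  rw [shiftAt_of_ne (Finset.ne_of_mem_erase hf)]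

theorem cellCoef_update_split (k : Fin 4) (c : Cell) (w : Word) (s : Sym) :
    cellCoef c (Function.update w k s) = s.coef (c k) * restCoef k c w := by
  unfold cellCoef restCoef
  rw [← Finset.mul_prod_erase Finset.univ (fun f => (Function.update w k s f).coef (c f)) (Finset.mem_univ k),
    Function.update_self]
  congr 1
  refine Finset.prod_congr rfl fun f hf => ?_
  rw [Function.update_of_ne (Finset.ne_of_mem_erase hf)]

theorem cellCoef_shiftAt_of_ne (k : Fin 4) (t : ℤ) (c : Cell) (w : Word) (h1 : w k ≠ Sym.h) (h2 : w k ≠ Sym.pt) :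
    cellCoef (shiftAt k t c) w = cellCoef c w := by
  rw [cellCoef_shiftAt_split, cellCoef_split k c w]
  congr 1
  generalize hs : w k = s
  cases s <;> simp_all [Sym.coef]

theorem cellCoef_shiftAt_h (k : Fin 4) (t : ℤ) (c : Cell) (w : Word) (hk : w k = Sym.h) :
    cellCoef (shiftAt k t c) w = cellCoef c w + (t : GaussianInt) * cellCoef c (Function.update w k Sym.one) := by
  rw [cellCoef_shiftAt_split, cellCoef_split k c w, cellCoef_update_split, hk]
  simp only [Sym.coef, shiftL_a, Int.cast_add]
  ring

theorem cellCoef_shiftAt_pt (k : Fin 4) (t : ℤ) (c : Cell) (w : Word) (hk : w k = Sym.pt) :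
    cellCoef (shiftAt k t c) w = cellCoef c w + 2 * (t : GaussianInt) * cellCoef c (Function.update w k Sym.h)
      + (t : GaussianInt) ^ 2 * cellCoef c (Function.update w k Sym.one) := by
  rw [cellCoef_shiftAt_split, cellCoef_split k c w, cellCoef_update_split, cellCoef_update_split, hk]
  simp only [Sym.coef, shiftL_selfInt, Int.cast_add, Int.cast_mul, Int.cast_pow, Int.cast_ofNat]
  ring

/-! ### The class tensor of `shiftAtD k t E` -/

theorem T_shiftAtD (k : Fin 4) (t : ℤ) (E : Design) (w : Word) :
    (shiftAtD k t E).T w = Tf E (fun c => cellCoef (shiftAt k t c) w) := T_mapD _ E w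

theorem T_shiftAtD_of_ne (k : Fin 4) (t : ℤ) (E : Design) (w : Word) (h1 : w k ≠ Sym.h) (h2 : w k ≠ Sym.pt) :
    (shiftAtD k t E).T w = E.T w := by
  rw [T_shiftAtD, T_eq_Tf]
  exact Tf_congr E fun c => cellCoef_shiftAt_of_ne k t c w h1 h2

theorem T_shiftAtD_h (k : Fin 4) (t : ℤ) (E : Design) (w : Word) (hk : w k = Sym.h) :
    (shiftAtD k t E).T w = E.T w + (t : GaussianInt) * E.T (Function.update w k Sym.one) := by
  rw [T_shiftAtD, T_eq_Tf, T_eq_Tf, ← Tf_smul, ← Tf_add]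
  exact Tf_congr E fun c => cellCoef_shiftAt_h k t c w hk

theorem T_shiftAtD_pt (k : Fin 4) (t : ℤ) (E : Design) (w : Word) (hk : w k = Sym.pt) :
    (shiftAtD k t E).T w = E.T w + 2 * (t : GaussianInt) * E.T (Function.update w k Sym.h)
      + (t : GaussianInt) ^ 2 * E.T (Function.update w k Sym.one) := by
  rw [T_shiftAtD, T_eq_Tf, T_eq_Tf, T_eq_Tf, ← Tf_smul, ← Tf_smul, ← Tf_add, ← Tf_add]
  exact Tf_congr E fun c => cellCoef_shiftAt_pt k t c w hk

/-! ## §4 (A1).1 and `μ` are preserved factor by factor -/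

/-- the first half of (A1): every e-mixed word other than `eeee`, `ēēēē` vanishes. -/
def MixedVanish (E : Design) : Prop :=
  ∀ w : Word, ¬ w.efree → w ≠ Word.eeee → w ≠ Word.EEEE → E.T w = 0

theorem not_efree_update {w : Word} (hw : ¬ w.efree) (k : Fin 4) (s : Sym) (hk : (w k).efree = true) (_hs : s.efree = true) :
    ¬ Word.efree (Function.update w k s) := by
  intro h
  apply hw
  intro f
  by_cases hf : f = k
  · subst hf; exact hk
  · have := h f
    rwa [Function.update_of_ne hf] at this

theorem update_ne_eeee (w : Word) (k : Fin 4) {s : Sym} (hs : s ≠ Sym.e) : Function.update w k s ≠ Word.eeee := by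
  intro h
  have := congrFun h k
  rw [Function.update_self] at this
  exact hs this

theorem update_ne_EEEE (w : Word) (k : Fin 4) {s : Sym} (hs : s ≠ Sym.ebar) : Function.update w k s ≠ Word.EEEE := by
  intro h
  have := congrFun h k
  rw [Function.update_self] at this
  exact hs this

theorem mixedVanish_shiftAtD (k : Fin 4) (t : ℤ) (E : Design) (hE : MixedVanish E) : MixedVanish (shiftAtD k t E) := by
  intro w hw he hE'
  have h1 : Function.update w k Sym.one ≠ Word.eeee := update_ne_eeee w k (s := Sym.one) (by decide)
  have h1' : Function.update w k Sym.one ≠ Word.EEEE := update_ne_EEEE w k (s := Sym.one) (by decide)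
  have h2 : Function.update w k Sym.h ≠ Word.eeee := update_ne_eeee w k (s := Sym.h) (by decide)
  have h2' : Function.update w k Sym.h ≠ Word.EEEE := update_ne_EEEE w k (s := Sym.h) (by decide)
  by_cases hh : w k = Sym.h
  · have hk : (w k).efree = true := by rw [hh]; rfl
    rw [T_shiftAtD_h k t E w hh, hE w hw he hE', hE _ (not_efree_update hw k Sym.one hk rfl) h1 h1']
    ring
  · by_cases hp : w k = Sym.pt
    · have hk : (w k).efree = true := by rw [hp]; rfl
      rw [T_shiftAtD_pt k t E w hp, hE w hw he hE', hE _ (not_efree_update hw k Sym.h hk rfl) h2 h2',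
        hE _ (not_efree_update hw k Sym.one hk rfl) h1 h1']
      ring
    · rw [T_shiftAtD_of_ne k t E w hh hp]
      exact hE w hw he hE'

theorem mu_shiftAtD (k : Fin 4) (t : ℤ) (E : Design) : (shiftAtD k t E).mu = E.mu := by
  unfold Design.mu
  exact T_shiftAtD_of_ne k t E Word.eeee (by simp [Word.eeee]) (by simp [Word.eeee])

theorem mixedVanish_shiftD (t : ℤ) (E : Design) (hE : MixedVanish E) : MixedVanish (shiftD t E) := by
  rw [shiftD_eq_shiftAtD]
  exact mixedVanish_shiftAtD 0 t _ (mixedVanish_shiftAtD 1 t _ (mixedVanish_shiftAtD 2 t _ (mixedVanish_shiftAtD 3 t _ hE)))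

theorem mu_shiftD (t : ℤ) (E : Design) : (shiftD t E).mu = E.mu := by
  rw [shiftD_eq_shiftAtD, mu_shiftAtD, mu_shiftAtD, mu_shiftAtD, mu_shiftAtD]


/-! ## §5 (A1).2 — e-free words of equal degree agree — is preserved by the FULL shift

A single-factor shift does NOT preserve (A1).2 (tensoring one factor by `O(h)` skews the degree filtration); the four-factor
shift does, by the binomial convolution `T'(w) = Σ_m C(d, m) t^{d−m} Λ(m)` (`d = deg w`). The kernel proof below avoids generating
functions: (α) (A1).2 ⇒ PAIR agreement on every pair of factors `{f, g}`; (β) pair agreement on `{f, g}` survives a shift of a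
third factor; (γ) it survives the shift of `f` and `g` together (an explicit 9-case letter calculus, `Hf = Ff ∘ deg`); (δ) pair
agreement on all six pairs ⇒ (A1).2, by a fixed six-move balancing schedule `bal 0 1, bal 0 2, bal 0 3, bal 1 2, bal 1 3, bal 2 3`
that brings every e-free word to a normal form depending only on its degree (checked by `omega`). -/

/-- the second half of (A1). -/
def EAgree (E : Design) : Prop :=
  ∀ w w' : Word, w.efree → w'.efree → w.deg = w'.deg → E.T w = E.T w'

theorem a1_iff (E : Design) : E.A1 ↔ MixedVanish E ∧ EAgree E := Iff.rfl

/-- PAIR AGREEMENT on the factors `{f, g}`: two e-free words that coincide off `{f, g}` and have the same degree on `{f, g}` have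
the same tensor coefficient. -/
def PairAgree (f g : Fin 4) (E : Design) : Prop :=
  ∀ v₁ v₂ : Word, v₁.efree → v₂.efree → (∀ k : Fin 4, k ≠ f → k ≠ g → v₁ k = v₂ k) →
    (v₁ f).deg + (v₁ g).deg = (v₂ f).deg + (v₂ g).deg → E.T v₁ = E.T v₂

/-! ### symbol and word bookkeeping -/

theorem Sym.deg_le_two (s : Sym) : s.deg ≤ 2 := by cases s <;> decide

theorem Sym.eq_of_efree_of_deg {a b : Sym} (ha : a.efree = true) (hb : b.efree = true) (h : a.deg = b.deg) : a = b := by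
  cases a <;> cases b <;> simp_all (config := { decide := true })

/-- the e-free symbol of a given degree (`≥ 2 ↦ pt`). -/
def ofDeg : ℕ → Sym
  | 0 => Sym.one
  | 1 => Sym.h
  | _ => Sym.pt

theorem ofDeg_efree (n : ℕ) : (ofDeg n).efree = true := by
  rcases n with _ | _ | n <;> rfl

theorem deg_ofDeg {n : ℕ} (hn : n ≤ 2) : (ofDeg n).deg = n := by
  rcases n with _ | _ | n
  · rfl
  · rfl
  · rcases n with _ | n
    · rfl
    · omega

theorem efree_update {w : Word} (hw : w.efree) (k : Fin 4) {s : Sym} (hs : s.efree = true) :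
    Word.efree (Function.update w k s) := by
  intro f
  by_cases hf : f = k
  · subst hf; simpa using hs
  · rw [Function.update_of_ne hf]; exact hw f

theorem Word.ext_of_efree {w w' : Word} (hw : w.efree) (hw' : w'.efree) (h : ∀ f, (w f).deg = (w' f).deg) : w = w' :=
  funext fun f => Sym.eq_of_efree_of_deg (hw f) (hw' f) (h f)

theorem deg_four (w : Word) : w.deg = (w 0).deg + (w 1).deg + (w 2).deg + (w 3).deg := by
  simp only [Word.deg, Fin.sum_univ_four]

/-- degree = pair degree + the rest. -/
theorem deg_split {f g : Fin 4} (hfg : f ≠ g) (v : Word) :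
    v.deg = (v f).deg + (v g).deg + ∑ k ∈ (Finset.univ.erase f).erase g, (v k).deg := by
  unfold Word.deg
  have hg : g ∈ Finset.univ.erase f := Finset.mem_erase.mpr ⟨Ne.symm hfg, Finset.mem_univ g⟩
  rw [← Finset.add_sum_erase Finset.univ (fun k => (v k).deg) (Finset.mem_univ f),
    ← Finset.add_sum_erase (Finset.univ.erase f) (fun k => (v k).deg) hg]
  ring

theorem rest_congr {f g : Fin 4} {v₁ v₂ : Word} (h : ∀ k : Fin 4, k ≠ f → k ≠ g → v₁ k = v₂ k) :
    ∑ k ∈ (Finset.univ.erase f).erase g, (v₁ k).deg = ∑ k ∈ (Finset.univ.erase f).erase g, (v₂ k).deg := by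
  refine Finset.sum_congr rfl fun k hk => ?_
  have hkg : k ≠ g := Finset.ne_of_mem_erase hk
  have hkf : k ≠ f := Finset.ne_of_mem_erase (Finset.mem_of_mem_erase hk)
  rw [h k hkf hkg]

/-- (α) (A1).2 ⇒ pair agreement on every pair. -/
theorem pairAgree_of_eAgree {f g : Fin 4} (hfg : f ≠ g) (E : Design) (hE : EAgree E) : PairAgree f g E := by
  intro v₁ v₂ h₁ h₂ hag hd
  refine hE v₁ v₂ h₁ h₂ ?_
  rw [deg_split hfg v₁, deg_split hfg v₂, rest_congr hag, hd]

/-- (β) pair agreement on `{f, g}` survives the shift of a third factor. -/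
theorem pairAgree_shiftAtD_of_ne {f g k : Fin 4} (hkf : k ≠ f) (hkg : k ≠ g) (t : ℤ) (E : Design)
    (hP : PairAgree f g E) : PairAgree f g (shiftAtD k t E) := by
  intro v₁ v₂ h₁ h₂ hag hd
  have hk : v₁ k = v₂ k := hag k hkf hkg
  -- the updated pairs again agree off {f,g} and have the same pair degree
  have hagU : ∀ s : Sym, ∀ k' : Fin 4, k' ≠ f → k' ≠ g → Function.update v₁ k s k' = Function.update v₂ k s k' := by
    intro s k' h1 h2
    by_cases hk' : k' = k
    · subst hk'; simp
    · rw [Function.update_of_ne hk', Function.update_of_ne hk', hag k' h1 h2]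
  have hdU : ∀ s : Sym, (Function.update v₁ k s f).deg + (Function.update v₁ k s g).deg
      = (Function.update v₂ k s f).deg + (Function.update v₂ k s g).deg := by
    intro s
    rw [Function.update_of_ne (Ne.symm hkf), Function.update_of_ne (Ne.symm hkg),
      Function.update_of_ne (Ne.symm hkf), Function.update_of_ne (Ne.symm hkg), hd]
  by_cases hh : v₁ k = Sym.h
  · rw [T_shiftAtD_h k t E v₁ hh, T_shiftAtD_h k t E v₂ (hk ▸ hh), hP v₁ v₂ h₁ h₂ hag hd,
      hP _ _ (efree_update h₁ k (s := Sym.one) rfl) (efree_update h₂ k (s := Sym.one) rfl) (hagU Sym.one) (hdU Sym.one)]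
  · by_cases hp : v₁ k = Sym.pt
    · rw [T_shiftAtD_pt k t E v₁ hp, T_shiftAtD_pt k t E v₂ (hk ▸ hp), hP v₁ v₂ h₁ h₂ hag hd,
        hP _ _ (efree_update h₁ k (s := Sym.one) rfl) (efree_update h₂ k (s := Sym.one) rfl) (hagU Sym.one) (hdU Sym.one),
        hP _ _ (efree_update h₁ k (s := Sym.h) rfl) (efree_update h₂ k (s := Sym.h) rfl) (hagU Sym.h) (hdU Sym.h)]
    · rw [T_shiftAtD_of_ne k t E v₁ hh hp, T_shiftAtD_of_ne k t E v₂ (hk ▸ hh) (hk ▸ hp)]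
      exact hP v₁ v₂ h₁ h₂ hag hd

/-! ### (γ) the two-factor letter calculus -/

/-- canonical e-free symbol pairs of pair degree `m = 0 … 4`. -/
def sig1 : ℕ → Sym
  | 0 => Sym.one
  | 1 => Sym.h
  | _ => Sym.pt

/-- second symbol of the canonical pair. -/
def sig2 : ℕ → Sym
  | 0 => Sym.one
  | 1 => Sym.one
  | 2 => Sym.one
  | 3 => Sym.h
  | _ => Sym.pt

theorem sig1_efree (m : ℕ) : (sig1 m).efree = true := by
  rcases m with _ | _ | m <;> rfl

theorem sig2_efree (m : ℕ) : (sig2 m).efree = true := by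
  rcases m with _ | _ | _ | _ | m <;> rfl

theorem deg_sig {m : ℕ} (hm : m ≤ 4) : (sig1 m).deg + (sig2 m).deg = m := by
  interval_cases m <;> rfl

/-- the canonical word of pair degree `m` over the base word `w`. -/
def canon (f g : Fin 4) (w : Word) (m : ℕ) : Word :=
  Function.update (Function.update w f (sig1 m)) g (sig2 m)

/-- `Λ(m)`: the common value of `T` on e-free words agreeing with `w` off `{f,g}` with pair degree `m`. -/
def Lam (E : Design) (f g : Fin 4) (w : Word) (m : ℕ) : GaussianInt := E.T (canon f g w m)

theorem update2_at_f {f g : Fin 4} (hfg : f ≠ g) (w : Word) (a b : Sym) :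
    Function.update (Function.update w f a) g b f = a := by
  rw [Function.update_of_ne hfg, Function.update_self]

theorem update2_at_g (f g : Fin 4) (w : Word) (a b : Sym) :
    Function.update (Function.update w f a) g b g = b := by
  rw [Function.update_self]

theorem update2_of_ne {f g k : Fin 4} (hkf : k ≠ f) (hkg : k ≠ g) (w : Word) (a b : Sym) :
    Function.update (Function.update w f a) g b k = w k := by
  rw [Function.update_of_ne hkg, Function.update_of_ne hkf]

/-- (L0) under pair agreement, `T` of any e-free word agreeing with `w` off `{f,g}` is `Λ` of its pair degree. -/
theorem T_eq_Lam {f g : Fin 4} (hfg : f ≠ g) {E : Design} (hP : PairAgree f g E) {w : Word} (hw : w.efree)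
    (v : Word) (hv : v.efree) (hvw : ∀ k : Fin 4, k ≠ f → k ≠ g → v k = w k) :
    E.T v = Lam E f g w ((v f).deg + (v g).deg) := by
  have hm : (v f).deg + (v g).deg ≤ 4 := by
    have := Sym.deg_le_two (v f); have := Sym.deg_le_two (v g); omega
  refine hP v (canon f g w _) hv ?_ ?_ ?_
  · exact efree_update (efree_update hw f (sig1_efree _)) g (sig2_efree _)
  · intro k hkf hkg
    rw [canon, update2_of_ne hkf hkg, hvw k hkf hkg]
  · rw [canon, update2_at_f hfg, update2_at_g, deg_sig hm]

/-- after the `g`-shift: `T'` as a function of the `f`-degree `i` and the `g`-symbol. -/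
def Gf (Λ : ℕ → GaussianInt) (t : ℤ) (i : ℕ) : Sym → GaussianInt
  | Sym.one => Λ i
  | Sym.h => Λ (i + 1) + (t : GaussianInt) * Λ i
  | Sym.pt => Λ (i + 2) + 2 * (t : GaussianInt) * Λ (i + 1) + (t : GaussianInt) ^ 2 * Λ i
  | Sym.e => 0
  | Sym.ebar => 0

/-- after both shifts: `T''` as a function of the two symbols. -/
def Hf (Λ : ℕ → GaussianInt) (t : ℤ) : Sym → Sym → GaussianInt
  | Sym.one, q => Gf Λ t 0 q
  | Sym.h, q => Gf Λ t 1 q + (t : GaussianInt) * Gf Λ t 0 q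
  | Sym.pt, q => Gf Λ t 2 q + 2 * (t : GaussianInt) * Gf Λ t 1 q + (t : GaussianInt) ^ 2 * Gf Λ t 0 q
  | Sym.e, _ => 0
  | Sym.ebar, _ => 0

/-- the binomial convolution `Σ_m C(d,m) t^{d−m} Λ(m)`, `d = 0 … 4`. -/
def Ff (Λ : ℕ → GaussianInt) (t : ℤ) : ℕ → GaussianInt
  | 0 => Λ 0
  | 1 => Λ 1 + (t : GaussianInt) * Λ 0
  | 2 => Λ 2 + 2 * (t : GaussianInt) * Λ 1 + (t : GaussianInt) ^ 2 * Λ 0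
  | 3 => Λ 3 + 3 * (t : GaussianInt) * Λ 2 + 3 * (t : GaussianInt) ^ 2 * Λ 1 + (t : GaussianInt) ^ 3 * Λ 0
  | 4 => Λ 4 + 4 * (t : GaussianInt) * Λ 3 + 6 * (t : GaussianInt) ^ 2 * Λ 2 + 4 * (t : GaussianInt) ^ 3 * Λ 1
      + (t : GaussianInt) ^ 4 * Λ 0
  | _ => 0

/-- THE LETTER CALCULUS: `Hf p q` depends only on `deg p + deg q` (nine binomial identities, `ring`). -/
theorem Hf_eq_Ff (Λ : ℕ → GaussianInt) (t : ℤ) {p q : Sym} (hp : p.efree = true) (hq : q.efree = true) :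
    Hf Λ t p q = Ff Λ t (p.deg + q.deg) := by
  cases p <;> cases q <;> simp [Sym.efree] at hp hq <;> simp only [Hf, Gf, Ff, Sym.deg] <;> ring

/-- (L1) one shift on `g`. -/
theorem T_shift_g {f g : Fin 4} (hfg : f ≠ g) {E : Design} (hP : PairAgree f g E) {w : Word} (hw : w.efree) (t : ℤ)
    (v : Word) (hv : v.efree) (hvw : ∀ k : Fin 4, k ≠ f → k ≠ g → v k = w k) :
    (shiftAtD g t E).T v = Gf (Lam E f g w) t (v f).deg (v g) := by
  have hag : ∀ s : Sym, ∀ k : Fin 4, k ≠ f → k ≠ g → Function.update v g s k = w k := by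
    intro s k hkf hkg; rw [Function.update_of_ne hkg, hvw k hkf hkg]
  cases hq : v g with
  | e => exact absurd (hv g) (by rw [hq]; decide)
  | ebar => exact absurd (hv g) (by rw [hq]; decide)
  | one =>
    rw [T_shiftAtD_of_ne g t E v (by rw [hq]; decide) (by rw [hq]; decide), T_eq_Lam hfg hP hw v hv hvw, hq]
    simp only [Gf, Sym.deg, add_zero]
  | h =>
    rw [T_shiftAtD_h g t E v hq, T_eq_Lam hfg hP hw v hv hvw, hq,
      T_eq_Lam hfg hP hw _ (efree_update hv g (s := Sym.one) rfl) (hag Sym.one),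
      Function.update_of_ne hfg, Function.update_self]
    simp only [Gf, Sym.deg, add_zero]
  | pt =>
    rw [T_shiftAtD_pt g t E v hq, T_eq_Lam hfg hP hw v hv hvw, hq,
      T_eq_Lam hfg hP hw _ (efree_update hv g (s := Sym.h) rfl) (hag Sym.h),
      T_eq_Lam hfg hP hw _ (efree_update hv g (s := Sym.one) rfl) (hag Sym.one),
      Function.update_of_ne hfg, Function.update_self, Function.update_of_ne hfg, Function.update_self]
    simp only [Gf, Sym.deg, add_zero]

/-- (L2) then one shift on `f`. -/
theorem T_shift_fg {f g : Fin 4} (hfg : f ≠ g) {E : Design} (hP : PairAgree f g E) {w : Word} (hw : w.efree) (t : ℤ)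
    (v : Word) (hv : v.efree) (hvw : ∀ k : Fin 4, k ≠ f → k ≠ g → v k = w k) :
    (shiftAtD f t (shiftAtD g t E)).T v = Hf (Lam E f g w) t (v f) (v g) := by
  have hag : ∀ s : Sym, ∀ k : Fin 4, k ≠ f → k ≠ g → Function.update v f s k = w k := by
    intro s k hkf hkg; rw [Function.update_of_ne hkf, hvw k hkf hkg]
  have hgf : g ≠ f := Ne.symm hfg
  cases hp : v f with
  | e => exact absurd (hv f) (by rw [hp]; decide)
  | ebar => exact absurd (hv f) (by rw [hp]; decide)
  | one =>
    rw [T_shiftAtD_of_ne f t _ v (by rw [hp]; decide) (by rw [hp]; decide), T_shift_g hfg hP hw t v hv hvw, hp]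
    simp only [Hf, Sym.deg]
  | h =>
    rw [T_shiftAtD_h f t _ v hp, T_shift_g hfg hP hw t v hv hvw, hp,
      T_shift_g hfg hP hw t _ (efree_update hv f (s := Sym.one) rfl) (hag Sym.one),
      Function.update_self, Function.update_of_ne hgf]
    simp only [Hf, Sym.deg]
  | pt =>
    rw [T_shiftAtD_pt f t _ v hp, T_shift_g hfg hP hw t v hv hvw, hp,
      T_shift_g hfg hP hw t _ (efree_update hv f (s := Sym.h) rfl) (hag Sym.h),
      T_shift_g hfg hP hw t _ (efree_update hv f (s := Sym.one) rfl) (hag Sym.one),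
      Function.update_self, Function.update_of_ne hgf, Function.update_self, Function.update_of_ne hgf]
    simp only [Hf, Sym.deg]

/-- (γ) pair agreement on `{f, g}` survives the simultaneous shift of `f` and `g`. -/
theorem pairAgree_shift_pair {f g : Fin 4} (hfg : f ≠ g) (t : ℤ) (E : Design) (hP : PairAgree f g E) :
    PairAgree f g (shiftAtD f t (shiftAtD g t E)) := by
  intro v₁ v₂ h₁ h₂ hag hd
  rw [T_shift_fg hfg hP h₁ t v₁ h₁ (fun _ _ _ => rfl),
    T_shift_fg hfg hP h₁ t v₂ h₂ (fun k hkf hkg => (hag k hkf hkg).symm),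
    Hf_eq_Ff _ t (h₁ f) (h₁ g), Hf_eq_Ff _ t (h₂ f) (h₂ g), hd]

/-! ### (δ) six pairs ⇒ (A1).2 : the balancing schedule -/

/-- move as much degree as possible from factor `j` onto factor `i`. -/
def bal (i j : Fin 4) (w : Word) : Word :=
  Function.update (Function.update w i (ofDeg (min ((w i).deg + (w j).deg) 2))) j
    (ofDeg ((w i).deg + (w j).deg - min ((w i).deg + (w j).deg) 2))

theorem bal_efree {i j : Fin 4} {w : Word} (hw : w.efree) : (bal i j w).efree :=
  efree_update (efree_update hw i (ofDeg_efree _)) j (ofDeg_efree _)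

theorem bal_of_ne {i j k : Fin 4} (hki : k ≠ i) (hkj : k ≠ j) (w : Word) : bal i j w k = w k :=
  update2_of_ne hki hkj w _ _

theorem deg_bal_i {i j : Fin 4} (hij : i ≠ j) (w : Word) : (bal i j w i).deg = min ((w i).deg + (w j).deg) 2 := by
  rw [bal, update2_at_f hij, deg_ofDeg (min_le_right _ _)]

theorem deg_bal_j (i j : Fin 4) (w : Word) :
    (bal i j w j).deg = (w i).deg + (w j).deg - min ((w i).deg + (w j).deg) 2 := by
  rw [bal, update2_at_g, deg_ofDeg]
  have := Sym.deg_le_two (w i); have := Sym.deg_le_two (w j); omega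

theorem T_bal {i j : Fin 4} (hij : i ≠ j) {E : Design} (hP : PairAgree i j E) {w : Word} (hw : w.efree) :
    E.T (bal i j w) = E.T w := by
  refine hP _ _ (bal_efree hw) hw (fun k hki hkj => bal_of_ne hki hkj w) ?_
  rw [deg_bal_i hij, deg_bal_j]
  have := Sym.deg_le_two (w i); have := Sym.deg_le_two (w j); omega

/-- the normal form: six balancing moves. -/
def nf (w : Word) : Word := bal 2 3 (bal 1 3 (bal 1 2 (bal 0 3 (bal 0 2 (bal 0 1 w)))))

theorem nf_efree {w : Word} (hw : w.efree) : (nf w).efree :=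
  bal_efree (bal_efree (bal_efree (bal_efree (bal_efree (bal_efree hw)))))

theorem Word.ext4 {w w' : Word} (h0 : w 0 = w' 0) (h1 : w 1 = w' 1) (h2 : w 2 = w' 2) (h3 : w 3 = w' 3) : w = w' := by
  funext k
  fin_cases k
  · exact h0
  · exact h1
  · exact h2
  · exact h3

/-- phase 1 (`bal 0 1, bal 0 2, bal 0 3`): factor `0` receives `min(deg, 2)`. -/
theorem phase1 (v : Word) :
    (bal 0 3 (bal 0 2 (bal 0 1 v)) 0).deg = min v.deg 2 ∧
      (bal 0 3 (bal 0 2 (bal 0 1 v)) 1).deg + (bal 0 3 (bal 0 2 (bal 0 1 v)) 2).deg + (bal 0 3 (bal 0 2 (bal 0 1 v)) 3).deg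
        = v.deg - min v.deg 2 := by
  have h01 : (0 : Fin 4) ≠ 1 := by decide
  have h02 : (0 : Fin 4) ≠ 2 := by decide
  have h03 : (0 : Fin 4) ≠ 3 := by decide
  have h12 : (1 : Fin 4) ≠ 2 := by decide
  have h13 : (1 : Fin 4) ≠ 3 := by decide
  have h23 : (2 : Fin 4) ≠ 3 := by decide
  have a0 := Sym.deg_le_two (v 0); have a1 := Sym.deg_le_two (v 1); have a2 := Sym.deg_le_two (v 2)
  have a3 := Sym.deg_le_two (v 3)
  simp only [deg_four, deg_bal_i h03, deg_bal_i h02, deg_bal_i h01, bal_of_ne h03.symm h23.symm,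
    bal_of_ne h03.symm h13.symm, bal_of_ne h01.symm h13, bal_of_ne h01.symm h12, deg_bal_j 0 1, bal_of_ne h02.symm h23,
    deg_bal_j 0 2, bal_of_ne h02.symm h12.symm, deg_bal_j 0 3]
  constructor <;> omega

/-- phase 2 (`bal 1 2, bal 1 3`): factor `1` receives `min(rest, 2)`. -/
theorem phase2 (Y : Word) :
    (bal 1 3 (bal 1 2 Y) 0).deg = (Y 0).deg ∧
      (bal 1 3 (bal 1 2 Y) 1).deg = min ((Y 1).deg + (Y 2).deg + (Y 3).deg) 2 ∧
      (bal 1 3 (bal 1 2 Y) 2).deg + (bal 1 3 (bal 1 2 Y) 3).deg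
        = (Y 1).deg + (Y 2).deg + (Y 3).deg - min ((Y 1).deg + (Y 2).deg + (Y 3).deg) 2 := by
  have h01 : (0 : Fin 4) ≠ 1 := by decide
  have h02 : (0 : Fin 4) ≠ 2 := by decide
  have h03 : (0 : Fin 4) ≠ 3 := by decide
  have h12 : (1 : Fin 4) ≠ 2 := by decide
  have h13 : (1 : Fin 4) ≠ 3 := by decide
  have h23 : (2 : Fin 4) ≠ 3 := by decide
  have a1 := Sym.deg_le_two (Y 1); have a2 := Sym.deg_le_two (Y 2); have a3 := Sym.deg_le_two (Y 3)
  have e0 : (bal 1 3 (bal 1 2 Y) 0).deg = (Y 0).deg := by rw [bal_of_ne h01 h03, bal_of_ne h01 h02]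
  have e1 : (bal 1 3 (bal 1 2 Y) 1).deg = min ((Y 1).deg + (Y 2).deg + (Y 3).deg) 2 := by
    simp only [deg_bal_i h13, deg_bal_i h12, bal_of_ne h13.symm h23.symm]
    omega
  have e2 : (bal 1 3 (bal 1 2 Y) 2).deg + (bal 1 3 (bal 1 2 Y) 3).deg
      = (Y 1).deg + (Y 2).deg + (Y 3).deg - min ((Y 1).deg + (Y 2).deg + (Y 3).deg) 2 := by
    simp only [bal_of_ne h12.symm h23, deg_bal_j 1 2, deg_bal_j 1 3, deg_bal_i h12, bal_of_ne h13.symm h23.symm]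
    omega
  exact ⟨e0, e1, e2⟩

/-- phase 3 (`bal 2 3`). -/
theorem phase3 (W : Word) :
    (bal 2 3 W 0).deg = (W 0).deg ∧ (bal 2 3 W 1).deg = (W 1).deg ∧
      (bal 2 3 W 2).deg = min ((W 2).deg + (W 3).deg) 2 ∧
      (bal 2 3 W 3).deg = (W 2).deg + (W 3).deg - min ((W 2).deg + (W 3).deg) 2 := by
  have h02 : (0 : Fin 4) ≠ 2 := by decide
  have h03 : (0 : Fin 4) ≠ 3 := by decide
  have h12 : (1 : Fin 4) ≠ 2 := by decide
  have h13 : (1 : Fin 4) ≠ 3 := by decide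
  have h23 : (2 : Fin 4) ≠ 3 := by decide
  rw [bal_of_ne h02 h03, bal_of_ne h12 h13, deg_bal_i h23, deg_bal_j 2 3]
  exact ⟨rfl, rfl, rfl, rfl⟩

/-- the degree vector of the normal form is a function of the total degree alone. -/
theorem nf_eq_of_deg {w w' : Word} (hw : w.efree) (hw' : w'.efree) (hd : w.deg = w'.deg) : nf w = nf w' := by
  obtain ⟨p0, p1⟩ := phase1 w
  obtain ⟨q0, q1, q2⟩ := phase2 (bal 0 3 (bal 0 2 (bal 0 1 w)))
  obtain ⟨r0, r1, r2, r3⟩ := phase3 (bal 1 3 (bal 1 2 (bal 0 3 (bal 0 2 (bal 0 1 w)))))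
  obtain ⟨p0', p1'⟩ := phase1 w'
  obtain ⟨q0', q1', q2'⟩ := phase2 (bal 0 3 (bal 0 2 (bal 0 1 w')))
  obtain ⟨r0', r1', r2', r3'⟩ := phase3 (bal 1 3 (bal 1 2 (bal 0 3 (bal 0 2 (bal 0 1 w')))))
  have e := nf_efree hw
  have e' := nf_efree hw'
  unfold nf at e e' ⊢
  refine Word.ext4 (Sym.eq_of_efree_of_deg (e 0) (e' 0) ?_) (Sym.eq_of_efree_of_deg (e 1) (e' 1) ?_)
    (Sym.eq_of_efree_of_deg (e 2) (e' 2) ?_) (Sym.eq_of_efree_of_deg (e 3) (e' 3) ?_)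
  · rw [r0, q0, p0, r0', q0', p0', hd]
  · rw [r1, q1, r1', q1']; omega
  · rw [r2, r2']; omega
  · rw [r3, r3']; omega

theorem T_nf (E : Design) (h01 : PairAgree 0 1 E) (h02 : PairAgree 0 2 E) (h03 : PairAgree 0 3 E)
    (h12 : PairAgree 1 2 E) (h13 : PairAgree 1 3 E) (h23 : PairAgree 2 3 E) {w : Word} (hw : w.efree) :
    E.T (nf w) = E.T w := by
  unfold nf
  rw [T_bal (by decide) h23 (bal_efree (bal_efree (bal_efree (bal_efree (bal_efree hw))))),
    T_bal (by decide) h13 (bal_efree (bal_efree (bal_efree (bal_efree hw)))),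
    T_bal (by decide) h12 (bal_efree (bal_efree (bal_efree hw))),
    T_bal (by decide) h03 (bal_efree (bal_efree hw)), T_bal (by decide) h02 (bal_efree hw), T_bal (by decide) h01 hw]

/-- (δ) pair agreement on all six pairs ⇒ (A1).2. -/
theorem eAgree_of_pairs (E : Design) (h01 : PairAgree 0 1 E) (h02 : PairAgree 0 2 E) (h03 : PairAgree 0 3 E)
    (h12 : PairAgree 1 2 E) (h13 : PairAgree 1 3 E) (h23 : PairAgree 2 3 E) : EAgree E := by
  intro w w' hw hw' hd
  rw [← T_nf E h01 h02 h03 h12 h13 h23 hw, ← T_nf E h01 h02 h03 h12 h13 h23 hw', nf_eq_of_deg hw hw' hd]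

/-! ### assembling the four shifts -/

theorem pairAgree_shiftD {f g k₁ k₂ : Fin 4} (hfg : f ≠ g) (h1f : k₁ ≠ f) (h1g : k₁ ≠ g) (h2f : k₂ ≠ f) (h2g : k₂ ≠ g)
    (t : ℤ) (E : Design) (hE : EAgree E)
    (hform : shiftD t E = shiftAtD f t (shiftAtD g t (shiftAtD k₁ t (shiftAtD k₂ t E)))) : PairAgree f g (shiftD t E) := by
  rw [hform]
  exact pairAgree_shift_pair hfg t _
    (pairAgree_shiftAtD_of_ne h1f h1g t _ (pairAgree_shiftAtD_of_ne h2f h2g t _ (pairAgree_of_eAgree hfg E hE)))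

theorem eAgree_shiftD (t : ℤ) (E : Design) (hE : EAgree E) : EAgree (shiftD t E) := by
  have e := shiftD_eq_shiftAtD t E
  refine eAgree_of_pairs _ ?_ ?_ ?_ ?_ ?_ ?_
  · exact pairAgree_shiftD (f := 0) (g := 1) (k₁ := 2) (k₂ := 3) (by decide) (by decide) (by decide) (by decide) (by decide)
      t E hE e
  · refine pairAgree_shiftD (f := 0) (g := 2) (k₁ := 1) (k₂ := 3) (by decide) (by decide) (by decide) (by decide)
      (by decide) t E hE ?_
    rw [e, shiftAtD_comm 1 2]
  · refine pairAgree_shiftD (f := 0) (g := 3) (k₁ := 1) (k₂ := 2) (by decide) (by decide) (by decide) (by decide)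
      (by decide) t E hE ?_
    rw [e, shiftAtD_comm 2 3, shiftAtD_comm 1 3]
  · refine pairAgree_shiftD (f := 1) (g := 2) (k₁ := 0) (k₂ := 3) (by decide) (by decide) (by decide) (by decide)
      (by decide) t E hE ?_
    rw [e, shiftAtD_comm 0 1, shiftAtD_comm 0 2]
  · refine pairAgree_shiftD (f := 1) (g := 3) (k₁ := 0) (k₂ := 2) (by decide) (by decide) (by decide) (by decide)
      (by decide) t E hE ?_
    rw [e, shiftAtD_comm 2 3, shiftAtD_comm 0 1, shiftAtD_comm 0 3]
  · refine pairAgree_shiftD (f := 2) (g := 3) (k₁ := 0) (k₂ := 1) (by decide) (by decide) (by decide) (by decide)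
      (by decide) t E hE ?_
    rw [e, shiftAtD_comm 0 1, shiftAtD_comm 0 2, shiftAtD_comm 0 3, shiftAtD_comm 1 2, shiftAtD_comm 1 3, shiftAtD_comm 0 1]

/-- (A1) IS SHIFT-INVARIANT. -/
theorem a1_shiftD (t : ℤ) (E : Design) (h1 : E.A1) : (shiftD t E).A1 :=
  ⟨mixedVanish_shiftD t E h1.1, eAgree_shiftD t E h1.2⟩


/-! ## §6 The height tower -/

/-- NONEX is inherited DOWN the tower: a valid design at height `h` shifts up to one at height `h + t` (`t ≥ 0`). -/
theorem nonex_of_nonex_up {h : ℤ} (t : ℤ) (ht : 0 ≤ t) {B : ℕ} {rmin : ℤ} (hn : Nonex (h + t) B rmin) :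
    Nonex h B rmin := by
  intro D hA h1 h4 hμ hB hr
  exact hn (shiftD t D) (onAlphabet_shift_up D h t ht hA) (a1_shiftD t D h1) (a4_shift D t h4)
    (by rw [mu_shiftD]; exact hμ) (by rw [copies_shift]; exact hB) (by rw [rank_shift]; exact hr)

/-- FLOOR-FREE(h, B, rmin): no (A1)-clean (A4) design with `μ ≠ 0`, copies `≤ B`, rank `≥ rmin` on the height-`h` alphabet
uses a FLOOR letter (`a = 0`, i.e. a letter of the deepest ring, co-level `h`). -/
def FloorFree (h : ℤ) (B : ℕ) (rmin : ℤ) : Prop :=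
  ∀ D : Design, D.OnAlphabet h → D.A1 → D.A4 → D.mu ≠ 0 → D.copies ≤ B → rmin ≤ D.rank →
    ∀ c ∈ D.suppN ++ D.suppP, ∀ f : Fin 4, 0 < (c f).a

/-- FLOOR-FREE(h) is the depth bound `c₀ = h − 1` at height `h` (deepest-ring exclusion). -/
theorem floorFree_iff_depthBound (h : ℤ) (B : ℕ) (rmin : ℤ) : FloorFree h B rmin ↔ DepthBound h B rmin (h - 1) := by
  constructor
  · intro H D hA h1 h4 hμ hB hr c hc f
    have ha := H D hA h1 h4 hμ hB hr c hc f
    have hh := (hA c hc f).1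
    unfold Letter.height at hh
    unfold Letter.colevel
    linarith
  · intro H D hA h1 h4 hμ hB hr c hc f
    have hcl := H D hA h1 h4 hμ hB hr c hc f
    have hh := (hA c hc f).1
    unfold Letter.height at hh
    unfold Letter.colevel at hcl
    linarith

theorem floorFree_of_nonex {h : ℤ} {B : ℕ} {rmin : ℤ} (hn : Nonex h B rmin) : FloorFree h B rmin :=
  fun D hA h1 h4 hμ hB hr => (hn D hA h1 h4 hμ hB hr).elim

/-- THE INDUCTIVE STEP: NONEX at height `h` and no floor letter at height `h + 1` ⇒ NONEX at height `h + 1`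
(a floor-free design at height `h + 1` shifts down to height `h`). -/
theorem nonex_succ_of {h : ℤ} {B : ℕ} {rmin : ℤ} (hn : Nonex h B rmin) (hf : FloorFree (h + 1) B rmin) :
    Nonex (h + 1) B rmin := by
  intro D hA h1 h4 hμ hB hr
  have hpos := hf D hA h1 h4 hμ hB hr
  refine hn (shiftD (-1) D) ?_ (a1_shiftD (-1) D h1) (a4_shift D (-1) h4)
    (by rw [mu_shiftD]; exact hμ) (by rw [copies_shift]; exact hB) (by rw [rank_shift]; exact hr)
  have hA' := onAlphabet_shift D (h + 1) (-1) hA (fun c hc f => by have := hpos c hc f; omega)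
  have e : h + 1 + (-1) = h := by ring
  rw [e] at hA'
  exact hA'

/-- one storey of the tower. -/
theorem nonex_succ_iff (h : ℤ) (B : ℕ) (rmin : ℤ) :
    Nonex (h + 1) B rmin ↔ Nonex h B rmin ∧ FloorFree (h + 1) B rmin :=
  ⟨fun hn => ⟨nonex_of_nonex_up 1 (by norm_num) hn, floorFree_of_nonex hn⟩, fun hh => nonex_succ_of hh.1 hh.2⟩

/-- THE TOWER: `Nonex (h + n) ↔ Nonex h ∧` every floor `h + 1, …, h + n` is free. -/
theorem nonex_add_iff (h : ℤ) (B : ℕ) (rmin : ℤ) (n : ℕ) :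
    Nonex (h + n) B rmin ↔ Nonex h B rmin ∧ ∀ j : ℕ, j < n → FloorFree (h + j + 1) B rmin := by
  induction n with
  | zero => simp
  | succ n ih =>
    have e : h + ((n + 1 : ℕ) : ℤ) = (h + n) + 1 := by push_cast; ring
    rw [e, nonex_succ_iff, ih]
    constructor
    · rintro ⟨⟨hn, hF⟩, hf⟩
      refine ⟨hn, fun j hj => ?_⟩
      rcases Nat.lt_succ_iff_lt_or_eq.mp hj with hj | rfl
      · exact hF j hj
      · exact hf
    · rintro ⟨hn, hF⟩
      exact ⟨⟨hn, fun j hj => hF j (Nat.lt_succ_of_lt hj)⟩, hF n (Nat.lt_succ_self n)⟩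

/-- RING CERTIFICATES ARE LOW-HEIGHT NON-EXISTENCE: for `c ≤ h`, `RingsEmpty h B rmin c ↔ Nonex c B rmin`
(shift by `h − c`: on the height-`h` alphabet, co-level `≤ c` ⟺ `a ≥ h − c`). -/
theorem ringsEmpty_iff_nonex {h c : ℤ} (hch : c ≤ h) (B : ℕ) (rmin : ℤ) :
    RingsEmpty h B rmin c ↔ Nonex c B rmin := by
  constructor
  · intro hR D hA h1 h4 hμ hB hr
    refine hR (shiftD (h - c) D) ?_ (a1_shiftD _ D h1) (a4_shift D _ h4) (by rw [mu_shiftD]; exact hμ)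
      (by rw [copies_shift]; exact hB) (by rw [rank_shift]; exact hr) ?_
    · have hA' := onAlphabet_shift_up D c (h - c) (by linarith) hA
      have e : c + (h - c) = h := by ring
      rw [e] at hA'
      exact hA'
    · exact colevel_shift D (h - c) c (fun c' hc' f => colevel_le_of_onAlphabet (hA c' hc' f))
  · intro hn D hA h1 h4 hμ hB hr hcol
    refine hn (shiftD (c - h) D) ?_ (a1_shiftD _ D h1) (a4_shift D _ h4) (by rw [mu_shiftD]; exact hμ)
      (by rw [copies_shift]; exact hB) (by rw [rank_shift]; exact hr)
    have hA' := onAlphabet_shift D h (c - h) hA (fun c' hc' f => by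
      have h1' := (hA c' hc' f).1
      have h2' := hcol c' hc' f
      unfold Letter.height at h1'
      unfold Letter.colevel at h2'
      linarith)
    have e : h + (c - h) = c := by ring
    rw [e] at hA'
    exact hA'

/-- DEPTH BOUND ⇒ the floors above `c₀` are free (shift up). -/
theorem floorFree_of_depthBound {h c₀ h' : ℤ} {B : ℕ} {rmin : ℤ} (hd : DepthBound h B rmin c₀) (h1 : c₀ < h') (h2 : h' ≤ h) :
    FloorFree h' B rmin := by
  intro D hA hA1 h4 hμ hB hr c hc f
  have hcol := hd (shiftD (h - h') D) ?_ (a1_shiftD _ D hA1) (a4_shift D _ h4) (by rw [mu_shiftD]; exact hμ)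
    (by rw [copies_shift]; exact hB) (by rw [rank_shift]; exact hr)
  · -- the shifted copy of `c` has co-level ≤ c₀; co-level is shift-invariant and equals h' − a on the alphabet
    have hc' : shiftCell (h - h') c ∈ (shiftD (h - h') D).suppN ++ (shiftD (h - h') D).suppP := by
      rw [suppN_shift, suppP_shift, ← List.map_append]
      exact List.mem_map.mpr ⟨c, hc, rfl⟩
    have := hcol _ hc' f
    simp only [shiftCell, shiftL_colevel] at this
    have hh := (hA c hc f).1
    unfold Letter.height at hh
    unfold Letter.colevel at this
    linarith
  · have hA' := onAlphabet_shift_up D h' (h - h') (by linarith) hA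
    have e : h' + (h - h') = h := by ring
    rw [e] at hA'
    exact hA'

/-! ## §7 The instance of record: `(h, B, rmin) = (14, 199, 8)` — NINE FLOORS -/

/-- gs-eng-2's ring-5 certificate `RingFiveEmpty.ringsEmpty_14_199_8_5 : RingsEmpty 14 199 8 5` IS `Nonex 5 199 8`
(taken as a hypothesis so that this file imports `IntegralityGap` only). -/
theorem nonex_five_of_rings (hR : RingsEmpty 14 199 8 5) : Nonex 5 199 8 :=
  (ringsEmpty_iff_nonex (by norm_num) 199 8).mp hR

/-- NINE FLOORS: given the ring-5 certificate, `Nonex 14 199 8` (⟺ `DepthBound 14 199 8 5`, `LegAIsNonex`) holds iff the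
floors at heights `6, 7, …, 14` are free — nine deepest-ring exclusions, one per storey. -/
theorem nonex_14_iff_nine_floors (hR : RingsEmpty 14 199 8 5) :
    Nonex 14 199 8 ↔ ∀ j : ℕ, j < 9 → FloorFree (5 + j + 1) 199 8 := by
  have key := nonex_add_iff 5 199 8 9
  have e : (5 : ℤ) + ((9 : ℕ) : ℤ) = 14 := by norm_num
  rw [e] at key
  rw [key]
  exact ⟨fun hh => hh.2, fun hh => ⟨nonex_five_of_rings hR, hh⟩⟩

/-- the same with the floors indexed by height. -/
theorem nonex_14_iff_floors (hR : RingsEmpty 14 199 8 5) :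
    Nonex 14 199 8 ↔ ∀ h : ℤ, 6 ≤ h → h ≤ 14 → FloorFree h 199 8 := by
  rw [nonex_14_iff_nine_floors hR]
  constructor
  · intro H h h6 h14
    obtain ⟨j, hj, rfl⟩ : ∃ j : ℕ, j < 9 ∧ h = 5 + (j : ℤ) + 1 := ⟨(h - 6).toNat, by omega, by omega⟩
    exact H j hj
  · intro H j hj
    exact H _ (by omega) (by omega)

/-- downward inheritance in the instance: NONEX at height 14 forces NONEX at every height `h ≤ 14`. -/
theorem nonex_le_of_nonex_14 (hn : Nonex 14 199 8) {h : ℤ} (hh : h ≤ 14) : Nonex h 199 8 := by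
  have e : h + (14 - h) = 14 := by ring
  refine nonex_of_nonex_up (14 - h) (by linarith) ?_
  rw [e]
  exact hn

end Summit.HodgeConjecture.HodgeConjecture.Cruxes.BlochSeedDiscOne.HeightTower
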